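import Mathlib
import Summits.ValiantsHypothesis.ValiantsHypothesis.Theorems.LiouvilleSarnakLiouvilleCutRankTwoAdicTwin

/-!
# Route LiouvilleSarnak — crux `DigitalBilinearLiouville` (stmt-ValiantsHypothesis-14774): the two-adic sign on a
# cut — truncated expansion and forced-bit counting (route-independent tools, part 1 of 3)

Tools for `Theorems/LiouvilleSarnakDigitalBilinearLiouvilleOddTwin.lean` ("the prime `2` is irrelevant for the
bilinear crux"):

* `one_add_two_mul_sum_negOnePow` — `1 + 2 Σ_{1 ≤ j ≤ m} (-1)^j [j ≤ t] = (-1)^{min(m,t)}`.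
* `twoAdicSign_cut_truncate` — for a cut `π`, bits `(r,c)` and `2K+1 ≤ 2n`, with `P_j` = "all row bits at positions
  `< j` and all column bits at positions `< j` are `1`": `f₀(N_π(r,c)+1) = (-1)^{v₂(N+1)}` equals
  `1 + 2 Σ_{j=1}^{2K} (-1)^j [P_j]` whenever `¬P_{2K+1}`, and always differs from it by at most `2` in norm
  (first-zero position `t` of the bit vector: `f₀ = (-1)^t`, `P_j ⟺ j ≤ t`).
* `card_filter_forced` — `#{r : Fin n → Bool | r = 1 on S} = 2^{n - #S}`; `card_forced_add` — row positions below
  `j` plus column positions below `j` number `j`.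

Honest framing: bookkeeping; no claim about the cruxes; nothing bears on `VP ≠ VNP`.  No definitions.
-/

set_option linter.dupNamespace false

noncomputable section

namespace Summit.ValiantsHypothesis.ValiantsHypothesis.Theorems.LiouvilleSarnakDigitalBilinearLiouville.OddTwinTruncation

open ArithmeticFunction Finset

open Summit.ValiantsHypothesis.ValiantsHypothesis.Theorems.LiouvilleSarnakLiouvilleCutRank.TwoAdicTwin
  (twoAdicSign_ofBits_succ)

/-! ### §1 The truncated expansion of the two-adic sign -/

/-- `1 + 2 Σ_{1 ≤ j ≤ m} (-1)^j [j ≤ t] = (-1)^{min(m,t)}`. [folklore] -/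
theorem one_add_two_mul_sum_negOnePow (t : ℕ) : ∀ m : ℕ,
    (1 : ℂ) + 2 * ∑ j ∈ Icc 1 m, (-1 : ℂ) ^ j * (if j ≤ t then 1 else 0) = (-1) ^ (min m t) := by
  intro m
  induction m with
  | zero => simp
  | succ m ih =>
    rw [Finset.sum_Icc_succ_top (by omega), mul_add, ← add_assoc, ih]
    by_cases h : m + 1 ≤ t
    · rw [if_pos h, min_eq_left h, min_eq_left (by omega), pow_succ]
      ring
    · rw [if_neg h, min_eq_right (by omega), min_eq_right (by omega)]
      ring

/-- **Truncated expansion of `f₀` on a cut.**  For a cut `π` of the `2n` positions, bits `r, c`, and `2K + 1 ≤ 2n`,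
let `P_j` = "every row position `< j` carries bit `1` and every column position `< j` carries bit `1`".  Then
(i) if `¬ P_{2K+1}` the sign `f₀(N+1) = (-1)^{v₂(N+1)}` equals `1 + 2 Σ_{j=1}^{2K} (-1)^j [P_j]`; (ii) in any case
the two differ by at most `2` in norm. [this file] -/
theorem twoAdicSign_cut_truncate (n K : ℕ) (hK : 2 * K + 1 ≤ 2 * n) (π : Fin n ⊕ Fin n ≃ Fin (2 * n))
    (r c : Fin n → Bool) :
    let N := Nat.ofBits (fun k : Fin (2 * n) => Sum.elim r c (π.symm k))
    let P : ℕ → Prop := fun j =>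
      (∀ i : Fin n, (π (Sum.inl i) : ℕ) < j → r i = true) ∧ (∀ i : Fin n, (π (Sum.inr i) : ℕ) < j → c i = true)
    (¬ P (2 * K + 1) →
        (-1 : ℂ) ^ ((N + 1).factorization 2) =
          1 + 2 * ∑ j ∈ Icc 1 (2 * K), (-1 : ℂ) ^ j * (if P j then 1 else 0)) ∧
      ‖(-1 : ℂ) ^ ((N + 1).factorization 2) -
          (1 + 2 * ∑ j ∈ Icc 1 (2 * K), (-1 : ℂ) ^ j * (if P j then 1 else 0))‖ ≤ 2 := by
  classical
  intro N P
  -- the bit vector as a function on `ℕ`, and its first zero `t ≤ 2n`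
  set g : ℕ → Bool := fun m => if h : m < 2 * n then Sum.elim r c (π.symm ⟨m, h⟩) else false with hg
  have hex : ∃ m, g m = false := ⟨2 * n, by simp [hg]⟩
  set t := Nat.find hex with ht
  have ht_spec : g t = false := Nat.find_spec hex
  have ht_min : ∀ m < t, g m = true := by
    intro m hm
    have := Nat.find_min hex hm
    simpa using this
  have ht_le : t ≤ 2 * n := by
    by_contra h
    have := ht_min (2 * n) (by omega)
    simp [hg] at this
  -- positions: `π (inl i) = j ⇒ bit j = r i`, etc.
  have hbit_l : ∀ i : Fin n, g (π (Sum.inl i)) = r i := by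
    intro i
    simp only [hg, (π (Sum.inl i)).isLt, dif_pos, Fin.eta, Equiv.symm_apply_apply, Sum.elim_inl]
  have hbit_r : ∀ i : Fin n, g (π (Sum.inr i)) = c i := by
    intro i
    simp only [hg, (π (Sum.inr i)).isLt, dif_pos, Fin.eta, Equiv.symm_apply_apply, Sum.elim_inr]
  -- `P j ⟺ j ≤ t` for `j ≤ 2n`
  have hP : ∀ j, j ≤ 2 * n → (P j ↔ j ≤ t) := by
    intro j hj
    constructor
    · rintro ⟨hl, hr⟩
      by_contra hjt
      rw [not_le] at hjt
      have htn : t < 2 * n := by omega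
      -- the bit at position `t` is `1` by `P j`, contradiction
      have : g t = true := by
        rcases hx : π.symm ⟨t, htn⟩ with i | i
        · have hpi : π (Sum.inl i) = ⟨t, htn⟩ := by rw [← hx, Equiv.apply_symm_apply]
          have h1 := hl i (by rw [hpi]; exact hjt)
          rw [← hbit_l i, hpi] at h1; exact h1
        · have hpi : π (Sum.inr i) = ⟨t, htn⟩ := by rw [← hx, Equiv.apply_symm_apply]
          have h1 := hr i (by rw [hpi]; exact hjt)
          rw [← hbit_r i, hpi] at h1; exact h1
      rw [ht_spec] at this; exact Bool.false_ne_true this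
    · intro hjt
      refine ⟨fun i hi => ?_, fun i hi => ?_⟩
      · rw [← hbit_l i]; exact ht_min _ (by omega)
      · rw [← hbit_r i]; exact ht_min _ (by omega)
  -- the sign is `(-1)^t`
  have hsign : (-1 : ℂ) ^ ((N + 1).factorization 2) = (-1) ^ t := by
    refine twoAdicSign_ofBits_succ (R := ℂ) _ t ht_le ?_ ?_
    · intro j hj
      have := ht_min j hj
      simpa [hg, j.isLt] using this
    · intro j hj
      have := ht_spec
      rw [← hj] at this
      simpa [hg, j.isLt] using this
  -- the truncated sum is `(-1)^{min(2K, t)}`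
  have hsum : (1 : ℂ) + 2 * ∑ j ∈ Icc 1 (2 * K), (-1 : ℂ) ^ j * (if P j then 1 else 0) =
      (-1) ^ (min (2 * K) t) := by
    rw [← one_add_two_mul_sum_negOnePow t (2 * K)]
    congr 2
    refine sum_congr rfl fun j hj => ?_
    rw [mem_Icc] at hj
    have hj2 : j ≤ 2 * n := by omega
    by_cases hjt : j ≤ t
    · rw [if_pos hjt, if_pos ((hP j hj2).mpr hjt)]
    · rw [if_neg hjt, if_neg (fun h => hjt ((hP j hj2).mp h))]
  refine ⟨fun hnP => ?_, ?_⟩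
  · rw [hsign, hsum]
    have htK : t < 2 * K + 1 := by
      by_contra h
      exact hnP ((hP _ hK).mpr (by omega))
    rw [min_eq_right (by omega)]
  · rw [hsign, hsum]
    refine (norm_sub_le _ _).trans ?_
    rw [norm_pow, norm_neg, norm_one, one_pow, norm_pow, norm_neg, norm_one, one_pow]
    norm_num

/-! ### §2 Counting the forced rows and columns -/

/-- The functions `Fin n → Bool` that are `true` on a given set `S` number `2^{n - #S}`. [folklore] -/
theorem card_filter_forced (n : ℕ) (S : Finset (Fin n)) :
    (Finset.univ.filter fun r : Fin n → Bool => ∀ i ∈ S, r i = true).card = 2 ^ (n - S.card) := by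
  classical
  -- bijection with functions on the complement of `S`
  let e : {r : Fin n → Bool // ∀ i ∈ S, r i = true} ≃ ({i : Fin n // i ∉ S} → Bool) :=
    { toFun := fun r i => r.1 i.1
      invFun := fun f => ⟨fun i => if h : i ∈ S then true else f ⟨i, h⟩, fun i hi => by simp [hi]⟩
      left_inv := by
        rintro ⟨r, hr⟩
        ext i
        by_cases hi : i ∈ S
        · simp [hi, hr i hi]
        · simp [hi]
      right_inv := by
        intro f
        funext ⟨i, hi⟩
        simp [hi] }
  have h1 : (Finset.univ.filter fun r : Fin n → Bool => ∀ i ∈ S, r i = true).card =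
      Fintype.card {r : Fin n → Bool // ∀ i ∈ S, r i = true} := by
    rw [Fintype.card_subtype]
  rw [h1, Fintype.card_congr e, Fintype.card_fun, Fintype.card_bool]
  congr 1
  rw [Fintype.card_subtype_compl, Fintype.card_fin]
  congr 1
  simp only [Fintype.card_subtype, Finset.filter_mem_eq_inter, Finset.univ_inter]

/-- Row positions below `j` plus column positions below `j` number `j` (`j ≤ 2n`). [folklore] -/
theorem card_forced_add (n : ℕ) (π : Fin n ⊕ Fin n ≃ Fin (2 * n)) (j : ℕ) (hj : j ≤ 2 * n) :
    (Finset.univ.filter fun i : Fin n => (π (Sum.inl i) : ℕ) < j).card +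
      (Finset.univ.filter fun i : Fin n => (π (Sum.inr i) : ℕ) < j).card = j := by
  classical
  rw [Finset.card_filter, Finset.card_filter]
  have h1 : (∑ i : Fin n, if (π (Sum.inl i) : ℕ) < j then 1 else 0) +
      (∑ i : Fin n, if (π (Sum.inr i) : ℕ) < j then 1 else 0) =
      ∑ x : Fin n ⊕ Fin n, if (π x : ℕ) < j then 1 else 0 := by
    rw [Fintype.sum_sum_type]
  rw [h1, Fintype.sum_equiv π (fun x => if (π x : ℕ) < j then 1 else 0)
    (fun p : Fin (2 * n) => if (p : ℕ) < j then 1 else 0) (fun x => rfl)]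
  rw [Fin.sum_univ_eq_sum_range (fun p => if p < j then 1 else 0) (2 * n)]
  rw [Finset.sum_ite, Finset.sum_const_zero, add_zero, Finset.sum_const, smul_eq_mul, mul_one]
  have h3 : (Finset.range (2 * n)).filter (fun p => p < j) = Finset.range j := by
    ext p
    simp only [Finset.mem_filter, Finset.mem_range]
    omega
  rw [h3, Finset.card_range]

end Summit.ValiantsHypothesis.ValiantsHypothesis.Theorems.LiouvilleSarnakDigitalBilinearLiouville.OddTwinTruncation

end
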